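import Summits.Ventures.CertifiedManyBodySolver.Downfold.EmeryBoxesHg1201JetWindowP10P1
import Summits.Ventures.CertifiedManyBodySolver.Downfold.EmeryBoxesHg1201JetWindowP10P2
import Summits.Ventures.CertifiedManyBodySolver.Downfold.EmeryBoxesHg1201JetWindowP10P3
import Summits.Ventures.CertifiedManyBodySolver.Downfold.EmeryFermiFillingLa214
import HarnessLib

/-!
# THE WHOLE-BAND (OBJECT-M) ONE-BAND SET AS CERTIFIED WINDOWS — HgBa₂CuO₄ at 10 GPa, n_H = 1.125 (ν = 7/16) — ASSEMBLED: `(t_J, t′_J/t_J, t″_J/t_J)` of the nodal 2-jet at ε_F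
# for EVERY member of box #19's σ companion at 10 GPa `emeryBoxHg1201P10` (INFL-3to1-B §B.101)

Venture CertifiedManyBodySolver, cell `pub/hubbard-downfold` (stage S1; INFLATION-RULES-3to1-B §B.101), seat hubbard-downfold-mod-4 (technique B = band
level, g45); namespace `Summit.Ventures.CertifiedManyBodySolver.Downfold.Emery`. Everything PROVED (`decide +kernel` on the bisection certificates of
`EmeryBandJetWindow.jetLeaf` — slope arithmetic `EmerySlopeArith(Sound)` — composed with the sub-box ε_F brackets of `EmeryFermiFillingHg1201Subs` and
`abFilling_fermiEnergyOf'`; generator HOME/hubbard-downfold-mod-4/jet-g45/gen/emit_boxes2.py, bit-exact python mirror of the kernel checker).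
WHAT THIS IS NOT: a statement about HgBa₂CuO₄ at 10 GPa — the typed box (box #19's σ companion at 10 GPa `emeryBoxHg1201P10` (Δ_pd [1.15, 2.5] × t_pd [1.39, 1.54] × t_pp [0.68, 0.79] eV, t_pp′ = 0.1156)) is SCREENING-GRADE; `U = 0` one-body kinematics of the σ model; the ε_F coupling is per
SUB-BOX (each member's jet is bounded over its sub-box's certified ε_F bracket, not at its own ε_F), so the windows are OUTER bounds of the true ranges.

| Δ_pd range | window |
|---|---|
| whole Δ_pd hull [1.15, 2.5] | t_J [0.4026, 0.5845] eV, t′_J/t_J [-0.1395, -0.0340], t″_J/t_J [0.0697, 0.2986] |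

Sources: [HybertsenSchluterChristensen1989, Eq. (1)]; [AndersenEtAl1995, §6]; [PavariniEtAl2001, Eq. (1)]; interval/slope arithmetic [folklore].
-/

noncomputable section

namespace Summit.Ventures.CertifiedManyBodySolver.Downfold.Emery

open Real Set Literature.Analysis.ValidatedNumerics.Numerics

/-- **HgBa₂CuO₄ at 10 GPa, whole Δ_pd hull [1.15, 2.5], n_H = 1.125 (ν = 7/16)** — for EVERY member θ = (Δ, t_pd, t_pp, t_pp′), with ε = ε_F(θ) and x₀ = xNode(ε_F): nodal-jet hopping
`t_J ∈ [0.4026, 0.5845]` eV, `t′_J/t_J ∈ [-0.1395, -0.0340]`, `t″_J/t_J ∈ [0.0697, 0.2986]` (union of the sub-box windows 0_0, 0_1, 1_0, 1_1, 2_0, 2_1, 3_0, 3_1). [folklore] -/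
theorem hg1201P10Box_jetWindow_nH1125 {Δ a b c : ℝ} (hΔ : Δ ∈ Icc (23 / 20 : ℝ) (5 / 2 : ℝ)) (ha : a ∈ Icc (139 / 100 : ℝ) (77 / 50 : ℝ))
    (hb : b ∈ Icc (17 / 25 : ℝ) (79 / 100 : ℝ)) (hc : c ∈ Icc (289 / 2500 : ℝ) (289 / 2500 : ℝ)) :
    jetT Δ a b c (xNode Δ a b c (fermiEnergyOf Δ a b c (7 / 16 : ℝ))) (fermiEnergyOf Δ a b c (7 / 16 : ℝ)) ∈ Icc (2013 / 5000 : ℝ) (1169 / 2000 : ℝ) ∧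
      jetTp Δ a b c (xNode Δ a b c (fermiEnergyOf Δ a b c (7 / 16 : ℝ))) (fermiEnergyOf Δ a b c (7 / 16 : ℝ)) / jetT Δ a b c (xNode Δ a b c (fermiEnergyOf Δ a b c (7 / 16 : ℝ))) (fermiEnergyOf Δ a b c (7 / 16 : ℝ)) ∈ Icc (-279 / 2000 : ℝ) (-17 / 500 : ℝ) ∧
      jetTpp Δ a b c (xNode Δ a b c (fermiEnergyOf Δ a b c (7 / 16 : ℝ))) (fermiEnergyOf Δ a b c (7 / 16 : ℝ)) / jetT Δ a b c (xNode Δ a b c (fermiEnergyOf Δ a b c (7 / 16 : ℝ))) (fermiEnergyOf Δ a b c (7 / 16 : ℝ)) ∈ Icc (697 / 10000 : ℝ) (1493 / 5000 : ℝ) := by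
  rcases mem_Icc_split hΔ (73 / 40 : ℝ) with hΔ | hΔ
  · rcases mem_Icc_split hΔ (119 / 80 : ℝ) with hΔ | hΔ
    · rcases mem_Icc_split ha (293 / 200 : ℝ) with ha' | ha'
      · exact (hg1201P10Jet_0_0 hΔ ha' hb hc).widen (by norm_num [SC]) (by norm_num [SC]) (by norm_num [SC])
          (by norm_num [SC]) (by norm_num [SC]) (by norm_num [SC])
      · exact (hg1201P10Jet_0_1 hΔ ha' hb hc).widen (by norm_num [SC]) (by norm_num [SC]) (by norm_num [SC])
          (by norm_num [SC]) (by norm_num [SC]) (by norm_num [SC])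
    · rcases mem_Icc_split ha (293 / 200 : ℝ) with ha' | ha'
      · exact (hg1201P10Jet_1_0 hΔ ha' hb hc).widen (by norm_num [SC]) (by norm_num [SC]) (by norm_num [SC])
          (by norm_num [SC]) (by norm_num [SC]) (by norm_num [SC])
      · exact (hg1201P10Jet_1_1 hΔ ha' hb hc).widen (by norm_num [SC]) (by norm_num [SC]) (by norm_num [SC])
          (by norm_num [SC]) (by norm_num [SC]) (by norm_num [SC])
  · rcases mem_Icc_split hΔ (173 / 80 : ℝ) with hΔ | hΔ
    · rcases mem_Icc_split ha (293 / 200 : ℝ) with ha' | ha'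
      · exact (hg1201P10Jet_2_0 hΔ ha' hb hc).widen (by norm_num [SC]) (by norm_num [SC]) (by norm_num [SC])
          (by norm_num [SC]) (by norm_num [SC]) (by norm_num [SC])
      · exact (hg1201P10Jet_2_1 hΔ ha' hb hc).widen (by norm_num [SC]) (by norm_num [SC]) (by norm_num [SC])
          (by norm_num [SC]) (by norm_num [SC]) (by norm_num [SC])
    · rcases mem_Icc_split ha (293 / 200 : ℝ) with ha' | ha'
      · exact (hg1201P10Jet_3_0 hΔ ha' hb hc).widen (by norm_num [SC]) (by norm_num [SC]) (by norm_num [SC])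
          (by norm_num [SC]) (by norm_num [SC]) (by norm_num [SC])
      · exact (hg1201P10Jet_3_1 hΔ ha' hb hc).widen (by norm_num [SC]) (by norm_num [SC]) (by norm_num [SC])
          (by norm_num [SC]) (by norm_num [SC]) (by norm_num [SC])

end Summit.Ventures.CertifiedManyBodySolver.Downfold.Emery
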